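import Mathlib.Analysis.Analytic.Uniqueness
import Mathlib.Analysis.Complex.CauchyIntegral
import Mathlib.Analysis.Complex.Convex
import Literature.NumberTheory.Automorphic.AutomorphicLFunctionFlathProofs
import HarnessLib

/-!
# The analytic glue of Jacquet–Shalika's Lemma (5.2): continuation from local quotient representations

Trunk `AutomorphicAxiomatic` (G19), topic `NumberTheory/Automorphic`; proof file (theorems only:
no definition, no named fact, no instance), on top of `AutomorphicLFunctionFlathProofs`, which rests
the named fact `multipliable_partialStandardL` of `AutomorphicLFunction` (Jacquet–Shalika (1981),
Thm. (5.3): the partial standard Euler product of a cuspidal automorphic representation of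
`GL_n(𝔸_K)` converges on `re s > 1`) on the single named input
`JacquetShalika1981_continuation_partialPairL_conj` (loc. cit. Lemma (5.2), p. 554: `L_S(s, π × π̄)`
continues analytically to `re s > 1`).

The printed proof of Lemma (5.2) (loc. cit. p. 555) is three lines on top of the global
Rankin–Selberg theory of §4: for cusp forms `φ ∈ π`, `φ' ∈ π̄` and a Schwartz–Bruhat function `Φ`
unramified outside `S`, the global integral `Ψ(s, W', W, Φ) = ∫ φ' φ E(·, Φ, s)` against the
mirabolic Eisenstein series is holomorphic on `re s > 1` ((4.6)), and equals
`A(s) L_S(s, π × π̄)` on the half-plane of absolute convergence of the Euler product, where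
`A(s) = ∏_{v ∈ S} Ψ_v(s, W'_v, W_v, Φ_v)` is the (holomorphic) product of the local integrals at
the places of `S`; and *given `s₀` the data may be chosen with `A(s₀) ≠ 0`* (§1 and §3 of the
source). "Hence `L_S = Ψ / A` is holomorphic at `s₀`." The same paradigm is Cogdell's account of
the continuation of `L(s, π × π')` (J. W. Cogdell, *Analytic theory of `L`-functions for `GL_n`*,
in: J. Bernstein, S. Gelbart (eds.), *An Introduction to the Langlands Program*, Birkhäuser (2003),
§4.1 and §4.2: "for any `s₀ ∈ ℂ` and any `v` there is a choice of local `W_v`, `W'_v`, and `Φ_v`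
such that `e_v(s₀; W_v, W'_v, Φ_v) ≠ 0` ... division by these factors can introduce no
extraneous poles").

This file proves the complex-analytic content of that last step once and for all, in the form
the global theory will have to feed it, and threads it to the named facts:

* `exists_differentiableOn_eqOn_of_local_quotients` — **patching local quotients.** Let `U ⊆ ℂ`
  be open and preconnected, `V ⊆ U` open and non-empty, `L : ℂ → ℂ` arbitrary. If for every
  `s₀ ∈ U` there are `I`, `A` holomorphic on `U` with `A(s₀) ≠ 0` and `I = A · L` on `V`, then
  some `F` holomorphic on `U` agrees with `L` on `V`. (By the identity theorem the "cross
  products" `I₀ A₁ = I₁ A₀` agree on all of `U`, so the quotients `I/A` patch; no hypothesis on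
  `L` is needed.) [folklore]
* `exists_continuation_halfPlane_of_local_quotients` — the half-plane form: `U = {re s > c}`,
  `V = {re s > max x₀ c}`.
* `JacquetShalika1981_continuation_partialPairL_conj_of_local_quotients` — **Lemma (5.2) from
  the Rankin–Selberg quotient representation**: if for every cuspidal `Π` there is a finite `S₀`
  such that for all finite `S ⊇ S₀` and every Satake family `α` of `Π` off `S` there is an
  abscissa `x₀` such that for every `s₀` with `re s₀ > 1` some `I`, `A` holomorphic on
  `re s > 1` satisfy `A(s₀) ≠ 0` and `I(s) = A(s) · L_S(s, α × ᾱ)` for `re s > max(x₀, 1)`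
  (`partialPairL S α (conjFamily α)`), then `JacquetShalika1981_continuation_partialPairL_conj`
  holds;
* `multipliable_partialStandardL_of_local_quotients`,
  `absolutelyConvergent_partialStandardL_of_local_quotients` — hence the named facts
  `multipliable_partialStandardL` and `absolutelyConvergent_partialStandardL` (Thm. (5.3) with
  Remark (5.4)) from the same hypothesis, via
  `multipliable_partialStandardL_of_continuation_partialPairL` /
  `absolutelyConvergent_partialStandardL_of_continuation_partialPairL`.

What remains for an unconditional `multipliable_partialStandardL_holds` is therefore exactly the
global Rankin–Selberg theory for `GL_n × GL_n` producing `I` (the global integral, holomorphic on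
`re s > 1` for `π' = π̄`: loc. cit. §4, (4.6); Cogdell (2003), Thm. 2.2), its Euler factorisation
with the unramified computation `Ψ_v = det(1 - q_v^{-s} A_v ⊗ Ā_v)⁻¹` for `v ∉ S` (loc. cit. §2;
Cogdell (2003), Thm. 2.2 and Thm. 3.3), and the local non-vanishing at the places of `S`
(loc. cit. §1, §3; Cogdell (2003), §4.2) — none of which is in the tree yet (no global Whittaker
coefficients, Schwartz–Bruhat functions on `𝔸_Kⁿ`, or mirabolic Eisenstein series).

## References

* H. Jacquet, J. A. Shalika, *On Euler products and the classification of automorphic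
  representations I*, Amer. J. Math. 103 (1981), 499–558: Lemma (5.2) and (5.1.4) p. 554, proof
  p. 555; §4 ((4.6)) [JacquetShalikaAJM1981].
* J. W. Cogdell, *Analytic theory of `L`-functions for `GL_n`*, in *An Introduction to the
  Langlands Program* (J. Bernstein, S. Gelbart, eds.), Birkhäuser (2003), Thm. 2.2, Thm. 3.3,
  §4.1–§4.2.
-/

noncomputable section

open Set Filter Topology NumberField IsDedekindDomain MeasureTheory

namespace Literature.NumberTheory.Automorphic

/-! ### Patching local quotient representations (complex analysis) -/

section Patching

/-- **Patching local quotients into a holomorphic continuation.** Let `U ⊆ ℂ` be open and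
preconnected, `V ⊆ U` open and non-empty, and `L : ℂ → ℂ` any function. Suppose that for every
`s₀ ∈ U` there are functions `I`, `A` holomorphic on `U` with `A s₀ ≠ 0` and `I = A * L` on `V`.
Then there is `F` holomorphic on `U` with `F = L` on `V`.

Proof: for two such pairs `(I₀, A₀)`, `(I₁, A₁)` the holomorphic functions `I₀ A₁` and `I₁ A₀`
agree on `V` (both are `A₀ A₁ L`), hence on `U` by the identity theorem; so
`F(s) := I_s(s) / A_s(s)` (the pair chosen at `s` itself) equals `I₀ / A₀` on the neighbourhood
`{A₀ ≠ 0}` of `s₀`, and equals `L` on `V`. This is the last step of the proof of Lemma (5.2) of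
Jacquet–Shalika (1981), p. 555 ("given `s₀` we may choose the data so that `A(s₀) ≠ 0`; hence
`L_S` is holomorphic at `s₀`"), and of Cogdell (2003), §4.1–§4.2. [folklore] -/
theorem exists_differentiableOn_eqOn_of_local_quotients {U V : Set ℂ} (hU : IsOpen U)
    (hUc : IsPreconnected U) (hV : IsOpen V) (hVU : V ⊆ U) (hVne : V.Nonempty) {L : ℂ → ℂ}
    (h : ∀ s₀ ∈ U, ∃ I A : ℂ → ℂ, DifferentiableOn ℂ I U ∧ DifferentiableOn ℂ A U ∧ A s₀ ≠ 0 ∧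
      EqOn I (A * L) V) :
    ∃ F : ℂ → ℂ, DifferentiableOn ℂ F U ∧ EqOn F L V := by
  choose! I A hI hA hA0 hIAL using h
  -- the cross identity `I s₀ * A s₁ = I s₁ * A s₀` on all of `U`
  have hcross : ∀ s₀ ∈ U, ∀ s₁ ∈ U, EqOn (I s₀ * A s₁) (I s₁ * A s₀) U := by
    intro s₀ hs₀ s₁ hs₁
    obtain ⟨z, hz⟩ := hVne
    have han₀ : AnalyticOnNhd ℂ (I s₀ * A s₁) U := ((hI s₀ hs₀).mul (hA s₁ hs₁)).analyticOnNhd hU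
    have han₁ : AnalyticOnNhd ℂ (I s₁ * A s₀) U := ((hI s₁ hs₁).mul (hA s₀ hs₀)).analyticOnNhd hU
    refine han₀.eqOn_of_preconnected_of_eventuallyEq han₁ hUc (hVU hz) ?_
    filter_upwards [hV.mem_nhds hz] with w hw
    have h₀ := hIAL s₀ hs₀ hw
    have h₁ := hIAL s₁ hs₁ hw
    simp only [Pi.mul_apply] at h₀ h₁ ⊢
    rw [h₀, h₁]; ring
  refine ⟨fun s => I s s / A s s, fun s₀ hs₀ => ?_, fun s hs => ?_⟩
  · -- holomorphy at `s₀`: on `W = U ∩ {A s₀ ≠ 0}` the function is `I s₀ / A s₀`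
    set W : Set ℂ := U ∩ A s₀ ⁻¹' {w | w ≠ 0} with hW
    have hWo : IsOpen W := (hA s₀ hs₀).continuousOn.isOpen_inter_preimage hU isOpen_ne
    have hsW : s₀ ∈ W := ⟨hs₀, hA0 s₀ hs₀⟩
    have hq : DifferentiableOn ℂ (fun s => I s₀ s / A s₀ s) W :=
      ((hI s₀ hs₀).mono inter_subset_left).div ((hA s₀ hs₀).mono inter_subset_left)
        fun w hw => hw.2
    have heq : EqOn (fun s => I s s / A s s) (fun s => I s₀ s / A s₀ s) W := by
      intro w hw
      have hAw : A w w ≠ 0 := hA0 w hw.1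
      have hA0w : A s₀ w ≠ 0 := hw.2
      have hc := hcross w hw.1 s₀ hs₀ hw.1
      simp only [Pi.mul_apply] at hc
      field_simp
      linear_combination hc
    exact ((hq.congr heq).differentiableAt (hWo.mem_nhds hsW)).differentiableWithinAt
  · -- agreement with `L` on `V`
    have hsU : s ∈ U := hVU hs
    have h₀ := hIAL s hsU hs
    simp only [Pi.mul_apply] at h₀
    show I s s / A s s = L s
    rw [h₀, mul_div_cancel_left₀ _ (hA0 s hsU)]

/-- **Half-plane form of the patching lemma.** If for every `s₀` with `re s₀ > c` there are `I`,
`A` holomorphic on `re s > c` with `A s₀ ≠ 0` and `I s = A s * L s` whenever `re s > c` and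
`re s > x₀`, then some `F` holomorphic on `re s > c` satisfies `F s = L s` for `re s > max x₀ c`.
[folklore] -/
theorem exists_continuation_halfPlane_of_local_quotients {c x₀ : ℝ} {L : ℂ → ℂ}
    (h : ∀ s₀ : ℂ, c < s₀.re → ∃ I A : ℂ → ℂ, DifferentiableOn ℂ I {s : ℂ | c < s.re} ∧
      DifferentiableOn ℂ A {s : ℂ | c < s.re} ∧ A s₀ ≠ 0 ∧
        ∀ s : ℂ, c < s.re → x₀ < s.re → I s = A s * L s) :
    ∃ F : ℂ → ℂ, DifferentiableOn ℂ F {s : ℂ | c < s.re} ∧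
      ∀ s : ℂ, max x₀ c < s.re → F s = L s := by
  have hVU : {s : ℂ | max x₀ c < s.re} ⊆ {s : ℂ | c < s.re} :=
    fun s (hs : max x₀ c < s.re) => show c < s.re from (le_max_right x₀ c).trans_lt hs
  have hVne : ({s : ℂ | max x₀ c < s.re} : Set ℂ).Nonempty :=
    ⟨((max x₀ c + 1 : ℝ) : ℂ), by
      show max x₀ c < ((max x₀ c + 1 : ℝ) : ℂ).re
      rw [Complex.ofReal_re]; linarith⟩
  obtain ⟨F, hF, hFL⟩ := exists_differentiableOn_eqOn_of_local_quotients
    (isOpen_lt continuous_const Complex.continuous_re) (convex_halfSpace_re_gt c).isPreconnected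
    (isOpen_lt continuous_const Complex.continuous_re) hVU hVne (L := L)
    (fun s₀ hs₀ => by
      obtain ⟨I, A, hI, hA, hA0, hIAL⟩ := h s₀ hs₀
      exact ⟨I, A, hI, hA, hA0, fun s (hs : max x₀ c < s.re) =>
        hIAL s (hVU hs) ((le_max_left x₀ c).trans_lt hs)⟩)
  exact ⟨F, hF, fun s hs => hFL hs⟩

end Patching

/-! ### Lemma (5.2) and Thm. (5.3) from the Rankin–Selberg quotient representation -/

section Lemma52

variable {n : ℕ} {K : Type} [Field K] [NumberField K]
  {μ : Measure (AdelicGroupData.gl n K).automorphicQuotient}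
  [(AdelicGroupData.gl n K).IsAutomorphicMeasure μ]

/-- **Continuation of one partial pair Euler product from local quotient representations.** If
for every `s₀` with `re s₀ > 1` there are `I`, `A` holomorphic on `re s > 1` with `A s₀ ≠ 0` and
`I s = A s · L^S(s, α × β)` (`partialPairL S α β s`) for `re s > 1`, `re s > x₀`, then
`L^S(s, α × β)` agrees on a right half-plane with a function holomorphic on `re s > 1` — the shape
asked for by `JacquetShalika1981_continuation_partialPairL_conj`. In the source `I` is the global
Rankin–Selberg integral `∫ φ φ' E(·, Φ, s)` and `A = ∏_{v ∈ S} Ψ_v` (Jacquet–Shalika (1981), §4 and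
p. 555; Cogdell (2003), Thm. 2.2, §4.1). [folklore] -/
theorem exists_continuation_partialPairL_of_local_quotients {S : Set (HeightOneSpectrum (𝓞 K))}
    {α β : SatakeFamily K} {x₀ : ℝ}
    (h : ∀ s₀ : ℂ, 1 < s₀.re → ∃ I A : ℂ → ℂ, DifferentiableOn ℂ I {s : ℂ | 1 < s.re} ∧
      DifferentiableOn ℂ A {s : ℂ | 1 < s.re} ∧ A s₀ ≠ 0 ∧
        ∀ s : ℂ, 1 < s.re → x₀ < s.re → I s = A s * partialPairL S α β s) :
    ∃ (F : ℂ → ℂ) (x₁ : ℝ), DifferentiableOn ℂ F {s : ℂ | 1 < s.re} ∧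
      ∀ s : ℂ, x₁ < s.re → F s = partialPairL S α β s := by
  obtain ⟨F, hF, hFL⟩ := exists_continuation_halfPlane_of_local_quotients h
  exact ⟨F, max x₀ 1, hF, hFL⟩

/-- **Jacquet–Shalika (1981), Lemma (5.2), from the Rankin–Selberg quotient representation.**
Suppose that for every cuspidal `Π` there is a finite set `S₀` of finite places such that for
every finite `S ⊇ S₀` and every Satake family `α` of `Π` off `S` there is an abscissa `x₀` with:
for every `s₀`, `re s₀ > 1`, there are `I`, `A` holomorphic on `re s > 1`, `A(s₀) ≠ 0`, with
`I(s) = A(s) · L_S(s, α × ᾱ)` for `re s > max(x₀, 1)` — in the source, `I = Ψ(s, W', W, Φ)` is the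
integral of `φ' φ` against the mirabolic Eisenstein series, holomorphic on `re s > 1` by (4.6),
`A(s) = ∏_{v ∈ S} Ψ_v(s, W'_v, W_v, Φ_v)`, non-zero at `s₀` for suitable data by §1 and §3, and the
identity is the Euler factorisation of §4 with the unramified computation of §2 on the half-plane
(5.1.4) of absolute convergence (loc. cit. p. 555). Then `L_S(s, π × π̄)` continues to `re s > 1`
(`JacquetShalika1981_continuation_partialPairL_conj`), by
`exists_continuation_partialPairL_of_local_quotients`.
[cite: JacquetShalikaAJM1981, Lemma (5.2), p. 554–555] -/
theorem JacquetShalika1981_continuation_partialPairL_conj_of_local_quotients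
    (h : ∀ P : CuspidalAutomorphicRepGL n K μ, ∃ S₀ : Finset (HeightOneSpectrum (𝓞 K)),
      ∀ ⦃S : Finset (HeightOneSpectrum (𝓞 K))⦄ ⦃α : SatakeFamily K⦄, S₀ ⊆ S →
        IsSatakeFamilyOf P ↑S α → ∃ x₀ : ℝ, ∀ s₀ : ℂ, 1 < s₀.re →
          ∃ I A : ℂ → ℂ, DifferentiableOn ℂ I {s : ℂ | 1 < s.re} ∧
            DifferentiableOn ℂ A {s : ℂ | 1 < s.re} ∧ A s₀ ≠ 0 ∧
              ∀ s : ℂ, 1 < s.re → x₀ < s.re →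
                I s = A s * partialPairL ↑S α (conjFamily α) s) :
    JacquetShalika1981_continuation_partialPairL_conj (μ := μ) := by
  intro P
  obtain ⟨S₀, hS₀⟩ := h P
  refine ⟨S₀, fun S α hS hα => ?_⟩
  obtain ⟨x₀, hx₀⟩ := hS₀ hS hα
  exact exists_continuation_partialPairL_of_local_quotients hx₀

/-- **Jacquet–Shalika's Thm. (5.3) (the named fact `multipliable_partialStandardL`) from the
Rankin–Selberg quotient representation** of `L_S(s, π × π̄)` (hypothesis as in
`JacquetShalika1981_continuation_partialPairL_conj_of_local_quotients`), via Lemma (5.2) and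
`multipliable_partialStandardL_of_continuation_partialPairL`.
[cite: JacquetShalikaAJM1981, Thm. (5.3), Lemma (5.2)] -/
theorem multipliable_partialStandardL_of_local_quotients
    (h : ∀ P : CuspidalAutomorphicRepGL n K μ, ∃ S₀ : Finset (HeightOneSpectrum (𝓞 K)),
      ∀ ⦃S : Finset (HeightOneSpectrum (𝓞 K))⦄ ⦃α : SatakeFamily K⦄, S₀ ⊆ S →
        IsSatakeFamilyOf P ↑S α → ∃ x₀ : ℝ, ∀ s₀ : ℂ, 1 < s₀.re →
          ∃ I A : ℂ → ℂ, DifferentiableOn ℂ I {s : ℂ | 1 < s.re} ∧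
            DifferentiableOn ℂ A {s : ℂ | 1 < s.re} ∧ A s₀ ≠ 0 ∧
              ∀ s : ℂ, 1 < s.re → x₀ < s.re →
                I s = A s * partialPairL ↑S α (conjFamily α) s) :
    multipliable_partialStandardL (μ := μ) :=
  multipliable_partialStandardL_of_continuation_partialPairL
    (JacquetShalika1981_continuation_partialPairL_conj_of_local_quotients h)

/-- **Thm. (5.3) with Remark (5.4) (the named fact `absolutelyConvergent_partialStandardL`) from
the Rankin–Selberg quotient representation**, via Lemma (5.2) and
`absolutelyConvergent_partialStandardL_of_continuation_partialPairL`.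
[cite: JacquetShalikaAJM1981, Thm. (5.3), Remark (5.4), Lemma (5.2)] -/
theorem absolutelyConvergent_partialStandardL_of_local_quotients
    (h : ∀ P : CuspidalAutomorphicRepGL n K μ, ∃ S₀ : Finset (HeightOneSpectrum (𝓞 K)),
      ∀ ⦃S : Finset (HeightOneSpectrum (𝓞 K))⦄ ⦃α : SatakeFamily K⦄, S₀ ⊆ S →
        IsSatakeFamilyOf P ↑S α → ∃ x₀ : ℝ, ∀ s₀ : ℂ, 1 < s₀.re →
          ∃ I A : ℂ → ℂ, DifferentiableOn ℂ I {s : ℂ | 1 < s.re} ∧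
            DifferentiableOn ℂ A {s : ℂ | 1 < s.re} ∧ A s₀ ≠ 0 ∧
              ∀ s : ℂ, 1 < s.re → x₀ < s.re →
                I s = A s * partialPairL ↑S α (conjFamily α) s) :
    absolutelyConvergent_partialStandardL (μ := μ) :=
  absolutelyConvergent_partialStandardL_of_continuation_partialPairL
    (JacquetShalika1981_continuation_partialPairL_conj_of_local_quotients h)

end Lemma52

end Literature.NumberTheory.Automorphic
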